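import Summits.Parity.GeneralizedHardyLittlewood.Theorems.PrimeLevelFamEdgeMomentsBeyondDiagonalLayersClassKernel
import HarnessLib

/-!
# Route `PrimeLevelFamEdge`, crux K_A `MomentsBeyondDiagonal` (stmt-Parity-20007), line «petersson_layers» v4:
# the CLASS SPLIT of a `k = 0` separated form (assembly step E3, assembled)

`…LayersSharpFlat` (sharp–flat reindexing) + `…LayersClassKernel` (class kernel) assembled into ONE identity and ONE
inequality for a general separated form with kernel `S(m₁n₁, m₂n₂; c)` — the shape of `stub_farP`'s remaining `k = 0` forms
(`…LayersFormReductionZero.subFar_rhoP_of_form_bound_zero`, with `a(m₁,m₂) = x_{d₁m₁}x_{d₂m₂}√(m₁m₂)`,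
`b(n₁,n₂) = 1_{d₁n₁d₂n₂≤Y}(d₁n₁d₂n₂)^{−1/2}W_{ij}(d₁n₁,d₂n₂)√(n₁n₂)`, `c = qr`):
* `neZero_div_classGcd`: the class modulus `c/g`, `g = ((s₁t₁, s₂t₂), c)`, is `≥ 1`;
* **`sum_four_kloosterman_eq_sum_classes`**:
  `Σ_{m₁≤X₁,n₁≤Y₁,m₂≤X₂,n₂≤Y₂} a(m₁,m₂) b(n₁,n₂) S(m₁n₁, m₂n₂; c)
   = Σ_{classes (s₁,t₁,s₂,t₂)} (φ(c)/φ(c/g)) · Σ_{f₁≤X₁/s₁,h₁≤Y₁/t₁,f₂≤X₂/s₂,h₂≤Y₂/t₂} A_s(f₁,f₂) B_t(h₁,h₂) S((s₁t₁/g)f₁f₂, (s₂t₂/g)h₁h₂; c/g)`,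
  `A_s = 1_{flats}·a(s₁·,s₂·)`, `B_t = 1_{flats}·b(t₁·,t₂·)` (sharp parts `sᵢ, tᵢ | c^∞`, flats prime to `c`);
* **`norm_sum_four_kloosterman_le_sum_classes`**: the corresponding bound `‖…‖ ≤ Σ_{classes} (φ(c)/φ(c/g))·‖class form‖`.
Each class form is a dilated bilinear Kloosterman form on plain boxes whose coefficients vanish off the flats, with Pascadi's
coprimality on the support (`…LayersClassKernel.coprime_class_normal_form`) — the input shape of
`…LayersBlockPascadiBound.norm_sum_four_le_of_pascadi` (modulus `c/g = q·(r/g)` when `q ∤ s₁t₁`, `classGcd_dvd_right`) and of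
`…LayersBlockFourierBound.norm_sum_four_le_fourier`.  Remaining (census steps E4–E6): per-class bounds, the class count
(`#{s ≤ X : s | c^∞} ≪ X^ε c^ε`), the large-sharp `ℓ²`-mass, the `q | r` layers, exponent bookkeeping; NOT done here.
Proof only (def-free helper); no form is bounded here; K_A NOT proved; nothing about Landau–Siegel zeros.
-/

noncomputable section

open Finset
open Literature.NumberTheory.LFunctions

namespace Summit.Parity.GeneralizedHardyLittlewood.Theorems.MomentsBeyondDiagonal.Layers

/-- The class modulus `c/((σ₁,σ₂),c)` is non-zero (`c ≥ 1`). [folklore] -/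
theorem neZero_div_classGcd (c : ℕ) [NeZero c] (σ₁ σ₂ : ℕ) : NeZero (c / Nat.gcd (Nat.gcd σ₁ σ₂) c) :=
  ⟨(Nat.div_pos (Nat.le_of_dvd (Nat.pos_of_ne_zero (NeZero.ne c)) (Nat.gcd_dvd_right _ _))
    (Nat.pos_of_ne_zero (Nat.gcd_ne_zero_right (NeZero.ne c)))).ne'⟩

/-- **The class split of a separated form with kernel `S(m₁n₁, m₂n₂; c)`.** [folklore] -/
theorem sum_four_kloosterman_eq_sum_classes {c : ℕ} [NeZero c] (X₁ Y₁ X₂ Y₂ : ℕ) (a b : ℕ → ℕ → ℂ) :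
    ∑ m₁ ∈ Icc 1 X₁, ∑ n₁ ∈ Icc 1 Y₁, ∑ m₂ ∈ Icc 1 X₂, ∑ n₂ ∈ Icc 1 Y₂,
        a m₁ m₂ * b n₁ n₂ * kloostermanSum c ((m₁ * n₁ : ℕ) : ZMod c) ((m₂ * n₂ : ℕ) : ZMod c) =
      ∑ s₁ ∈ (Icc 1 X₁).filter (fun s ↦ s ∈ Nat.factoredNumbers c.primeFactors),
      ∑ t₁ ∈ (Icc 1 Y₁).filter (fun s ↦ s ∈ Nat.factoredNumbers c.primeFactors),
      ∑ s₂ ∈ (Icc 1 X₂).filter (fun s ↦ s ∈ Nat.factoredNumbers c.primeFactors),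
      ∑ t₂ ∈ (Icc 1 Y₂).filter (fun s ↦ s ∈ Nat.factoredNumbers c.primeFactors),
        ((c.totient : ℂ) / ((c / Nat.gcd (Nat.gcd (s₁ * t₁) (s₂ * t₂)) c).totient : ℂ)) *
        ∑ f₁ ∈ Icc 1 (X₁ / s₁), ∑ h₁ ∈ Icc 1 (Y₁ / t₁), ∑ f₂ ∈ Icc 1 (X₂ / s₂), ∑ h₂ ∈ Icc 1 (Y₂ / t₂),
          (if Nat.Coprime f₁ c ∧ Nat.Coprime f₂ c then a (s₁ * f₁) (s₂ * f₂) else 0) *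
            (if Nat.Coprime h₁ c ∧ Nat.Coprime h₂ c then b (t₁ * h₁) (t₂ * h₂) else 0) *
            @kloostermanSum (c / Nat.gcd (Nat.gcd (s₁ * t₁) (s₂ * t₂)) c) (neZero_div_classGcd c (s₁ * t₁) (s₂ * t₂))
              ((s₁ * t₁ / Nat.gcd (Nat.gcd (s₁ * t₁) (s₂ * t₂)) c * (f₁ * f₂) : ℕ) :
                ZMod (c / Nat.gcd (Nat.gcd (s₁ * t₁) (s₂ * t₂)) c))
              ((s₂ * t₂ / Nat.gcd (Nat.gcd (s₁ * t₁) (s₂ * t₂)) c * (h₁ * h₂) : ℕ) :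
                ZMod (c / Nat.gcd (Nat.gcd (s₁ * t₁) (s₂ * t₂)) c)) := by
  rw [sum_four_eq_sum_sharp_classes (NeZero.ne c) X₁ Y₁ X₂ Y₂
    (fun m₁ n₁ m₂ n₂ ↦ a m₁ m₂ * b n₁ n₂ * kloostermanSum c ((m₁ * n₁ : ℕ) : ZMod c) ((m₂ * n₂ : ℕ) : ZMod c))]
  refine sum_congr rfl fun s₁ _ ↦ sum_congr rfl fun t₁ _ ↦ sum_congr rfl fun s₂ _ ↦ sum_congr rfl fun t₂ _ ↦ ?_
  haveI := neZero_div_classGcd c (s₁ * t₁) (s₂ * t₂)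
  exact classForm_eq s₁ t₁ s₂ t₂ (X₁ / s₁) (Y₁ / t₁) (X₂ / s₂) (Y₂ / t₂) a b

/-- The class factor is a non-negative real: `‖φ(c)/φ(c/g)‖ = φ(c)/φ(c/g)`. [folklore] -/
theorem norm_totient_div (c c' : ℕ) :
    ‖((c.totient : ℂ) / (c'.totient : ℂ))‖ = (c.totient : ℝ) / (c'.totient : ℝ) := by
  rw [norm_div, Complex.norm_natCast, Complex.norm_natCast]

/-- **The class split as a bound**: `‖Σ a b S(m₁n₁,m₂n₂;c)‖ ≤ Σ_{classes} (φ(c)/φ(c/g)) · ‖class form‖`. [folklore] -/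
theorem norm_sum_four_kloosterman_le_sum_classes {c : ℕ} [NeZero c] (X₁ Y₁ X₂ Y₂ : ℕ) (a b : ℕ → ℕ → ℂ) :
    ‖∑ m₁ ∈ Icc 1 X₁, ∑ n₁ ∈ Icc 1 Y₁, ∑ m₂ ∈ Icc 1 X₂, ∑ n₂ ∈ Icc 1 Y₂,
        a m₁ m₂ * b n₁ n₂ * kloostermanSum c ((m₁ * n₁ : ℕ) : ZMod c) ((m₂ * n₂ : ℕ) : ZMod c)‖ ≤
      ∑ s₁ ∈ (Icc 1 X₁).filter (fun s ↦ s ∈ Nat.factoredNumbers c.primeFactors),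
      ∑ t₁ ∈ (Icc 1 Y₁).filter (fun s ↦ s ∈ Nat.factoredNumbers c.primeFactors),
      ∑ s₂ ∈ (Icc 1 X₂).filter (fun s ↦ s ∈ Nat.factoredNumbers c.primeFactors),
      ∑ t₂ ∈ (Icc 1 Y₂).filter (fun s ↦ s ∈ Nat.factoredNumbers c.primeFactors),
        ((c.totient : ℝ) / ((c / Nat.gcd (Nat.gcd (s₁ * t₁) (s₂ * t₂)) c).totient : ℝ)) *
        ‖∑ f₁ ∈ Icc 1 (X₁ / s₁), ∑ h₁ ∈ Icc 1 (Y₁ / t₁), ∑ f₂ ∈ Icc 1 (X₂ / s₂), ∑ h₂ ∈ Icc 1 (Y₂ / t₂),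
          (if Nat.Coprime f₁ c ∧ Nat.Coprime f₂ c then a (s₁ * f₁) (s₂ * f₂) else 0) *
            (if Nat.Coprime h₁ c ∧ Nat.Coprime h₂ c then b (t₁ * h₁) (t₂ * h₂) else 0) *
            @kloostermanSum (c / Nat.gcd (Nat.gcd (s₁ * t₁) (s₂ * t₂)) c) (neZero_div_classGcd c (s₁ * t₁) (s₂ * t₂))
              ((s₁ * t₁ / Nat.gcd (Nat.gcd (s₁ * t₁) (s₂ * t₂)) c * (f₁ * f₂) : ℕ) :
                ZMod (c / Nat.gcd (Nat.gcd (s₁ * t₁) (s₂ * t₂)) c))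
              ((s₂ * t₂ / Nat.gcd (Nat.gcd (s₁ * t₁) (s₂ * t₂)) c * (h₁ * h₂) : ℕ) :
                ZMod (c / Nat.gcd (Nat.gcd (s₁ * t₁) (s₂ * t₂)) c))‖ := by
  rw [sum_four_kloosterman_eq_sum_classes X₁ Y₁ X₂ Y₂ a b]
  refine (norm_sum_le _ _).trans (sum_le_sum fun s₁ _ ↦ (norm_sum_le _ _).trans (sum_le_sum fun t₁ _ ↦
    (norm_sum_le _ _).trans (sum_le_sum fun s₂ _ ↦ (norm_sum_le _ _).trans (sum_le_sum fun t₂ _ ↦ ?_))))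
  rw [norm_mul, norm_totient_div]

end Summit.Parity.GeneralizedHardyLittlewood.Theorems.MomentsBeyondDiagonal.Layers

end
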